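import Mathlib
import Summits.KontsevichZagierPeriods.KontsevichZagierPeriods.Theorems.InverseLandauTateLiftingLowDimAlgSector
import Summits.KontsevichZagierPeriods.KontsevichZagierPeriods.Theorems.InverseLandauTateLiftingCylinderTame
import Summits.KontsevichZagierPeriods.KontsevichZagierPeriods.Theorems.InverseLandauTateLiftingCylinderStokes
import Summits.KontsevichZagierPeriods.KontsevichZagierPeriods.Theorems.InverseLandauTateLiftingCylinderBase
import Summits.KontsevichZagierPeriods.KontsevichZagierPeriods.Theorems.InverseLandauTateLiftingIntervalPolyPoint
import Summits.KontsevichZagierPeriods.KontsevichZagierPeriods.Theorems.InverseLandauTateLiftingPointMul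
import Literature.NumberTheory.Transcendental.KZProductIdeal

/-!
# `TateLifting` (stmt-KontsevichZagierPeriods-9129), line `Sketch` — the all-dimensional cylinder /
Fubini sector: reduction file

Crux `Summit.KontsevichZagierPeriods.KontsevichZagierPeriods.Theses.InverseLandau.TateLifting`
(`ker KZ.eval ⊆ KZ.relations ⊔ closure T`, `T` = Tate fibres) is Conjecture-1-strength in general; the
line lands the SECTORS on which it is a theorem. After the dimension-≤-1 sectors
(`Theorems/InverseLandauTateLiftingDimOneSector.lean`, `…LowDimAlgSector.lean`) this file lands the first
sector with generators of EVERY dimension: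

* a CYLINDER representation is an honest representation over the open cube `(0,1)ⁿ⁺¹` whose integrand is
  `P(z)/q(z₀)` with `P ∈ K[z₀,…,z_n]`, `q ∈ K[x]`, `K = ℚ̄ ∩ ℝ` (`algebraicClosure ℚ ℝ`) and `q ≠ 0` on
  `[0,1]` (value: a `K`-combination of the Baker periods `∫₀¹ xⁱ/q`); with `q = 1` these are the
  POLYNOMIAL CUBES `[(0,1)ⁿ, P]` of every dimension;
* `Fubini.cylinderReduce`, `Fubini.cylinder_toDimOne` — `n` cubical Stokes moves along the last coordinate
  (`tateLifting_cylinderStokes`: primitive `∫P dz_n / q(z₀)`, analytic near the closed cube) bring a cylinder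
  representation to a dimension-one representation with algebraic-coefficient integrand (the landed sector);
* `Fubini.cubePoly_toPoint` — a polynomial cube of any dimension differs by relations from a representation
  over the point `ℝ⁰` (`tateLifting_intervalPolyPoint` for the last step);
* `Fubini.reduce` — every FUBINI GENERATOR (a low-dimensional generator of `kzKernelConjecture_lowDimAlg`, a
  cylinder representation of any dimension, or a Fubini product — `*` of `KZProduct`, either order — of one of
  these with a representation over `ℝ⁰` or a polynomial cube) is congruent modulo `KZ.relations` to an element
  of the subgroup generated by the low-dimensional generators (product closure through `tateLifting_pointMul`
  and the ideal structure of `KZProductIdeal`: `relations` is a two-sided ideal, `*` is commutative modulo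
  relations);
* `tateLifting_cubePolyPoint` — the registered packaging of `Fubini.cubePoly_toPoint`.

The sector theorems themselves (`fubiniLowDimKernel`, `TateLifting_fubiniSector`, `kzPeriodConjecture_cubePoly`,
`kzPeriodConjecture_cylinder`, `kzPeriodConjecture_cubePoly_prod_dimOneAlg`) are in the companion file
`Theorems/InverseLandauTateLiftingFubiniSector.lean`.

References: M. Kontsevich, D. Zagier, *Periods* (2001), §§1.1–1.2, §4.1 ("the product of integrals is again
an integral (Fubini formula)"); A. Baker, *Transcendental Number Theory* (1975), Thm 2.1 (through the landed
dimension-one kernel).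
-/

noncomputable section

namespace Summit.KontsevichZagierPeriods.InverseLandau

open MeasureTheory Set
open Literature.NumberTheory.Transcendental

namespace Fubini

/-! ### Cylinder reduction -/

/-- **Cylinder reduction**: `n` cubical Stokes steps (`tateLifting_cylinderStokes`, fed with
`tateLifting_cylinderTame`) bring a cylinder representation of dimension `n + 1` to a cylinder representation
of dimension `1` with the same denominator, modulo relations. [cite: KontsevichZagier2001, §1.2] -/
theorem cylinderReduce :
    ∀ (n : ℕ) (P : MvPolynomial (Fin (n + 1)) (algebraicClosure ℚ ℝ))
      (q : Polynomial (algebraicClosure ℚ ℝ)) (r : KZ.IntegralRep (n + 1)),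
      (∀ t ∈ Set.Icc (0 : ℝ) 1, Polynomial.aeval t q ≠ 0) →
      r.domain = Set.pi Set.univ (fun _ => Set.Ioo (0 : ℝ) 1) →
      Set.EqOn r.integrand (fun z => MvPolynomial.aeval z P / Polynomial.aeval (z 0) q) r.domain →
      ∃ (P₁ : MvPolynomial (Fin 1) (algebraicClosure ℚ ℝ)) (r₁ : KZ.IntegralRep 1),
        r₁.domain = Set.pi Set.univ (fun _ => Set.Ioo (0 : ℝ) 1) ∧
        Set.EqOn r₁.integrand (fun z => MvPolynomial.aeval z P₁ / Polynomial.aeval (z 0) q) r₁.domain ∧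
        KZ.of r - KZ.of r₁ ∈ KZ.relations := by
  intro n
  induction n with
  | zero =>
    intro P q r _ hd hi
    exact ⟨P, r, hd, hi, by rw [sub_self]; exact KZ.relations.zero_mem⟩
  | succ k ih =>
    intro P q r hq hd hi
    obtain ⟨P', r', hd', hi', hrel⟩ :=
      tateLifting_cylinderStokes tateLifting_cylinderTame k P q r hq hd hi
    obtain ⟨P₁, r₁, hd₁, hi₁, hrel₁⟩ := ih P' q r' hq hd' hi'
    refine ⟨P₁, r₁, hd₁, hi₁, ?_⟩
    have : KZ.of r - KZ.of r₁ = (KZ.of r - KZ.of r') + (KZ.of r' - KZ.of r₁) := by abel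
    rw [this]
    exact KZ.relations.add_mem hrel hrel₁

/-- **Cylinder representations land in the dimension-one algebraic sector**: after `cylinderReduce`, the
dimension-one reading `tateLifting_cylinderBase` exhibits the reduced representation as a generator of the
landed sector `kzKernelConjecture_lowDimAlg` (real polynomials with real-algebraic coefficients, `q ≠ 0` on the
domain). [cite: KontsevichZagier2001, §1.2] -/
theorem cylinder_toDimOne :
    ∀ (n : ℕ) (P : MvPolynomial (Fin (n + 1)) (algebraicClosure ℚ ℝ))
      (q : Polynomial (algebraicClosure ℚ ℝ)) (r : KZ.IntegralRep (n + 1)),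
      (∀ t ∈ Set.Icc (0 : ℝ) 1, Polynomial.aeval t q ≠ 0) →
      r.domain = Set.pi Set.univ (fun _ => Set.Ioo (0 : ℝ) 1) →
      Set.EqOn r.integrand (fun z => MvPolynomial.aeval z P / Polynomial.aeval (z 0) q) r.domain →
      ∃ (ρ : KZ.IntegralRep 1) (p q' : Polynomial ℝ), (∀ i, IsAlgebraic ℚ (p.coeff i)) ∧
        (∀ i, IsAlgebraic ℚ (q'.coeff i)) ∧ (∀ x ∈ ρ.domain, q'.eval (x 0) ≠ 0) ∧
        Set.EqOn ρ.integrand (fun x => p.eval (x 0) / q'.eval (x 0)) ρ.domain ∧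
        KZ.of r - KZ.of ρ ∈ KZ.relations := by
  intro n P q r hq hd hi
  obtain ⟨P₁, r₁, hd₁, hi₁, hrel⟩ := cylinderReduce n P q r hq hd hi
  obtain ⟨p, q', hp, hq', hread⟩ := tateLifting_cylinderBase P₁ q
  refine ⟨r₁, p, q', hp, hq', fun x hx => ?_, fun x hx => ?_, hrel⟩
  · rw [← (hread x).2]
    refine hq (x 0) (Set.Ioo_subset_Icc_self ?_)
    rw [hd₁] at hx
    exact Set.mem_univ_pi.mp hx 0
  · rw [hi₁ hx]
    show MvPolynomial.aeval x P₁ / Polynomial.aeval (x 0) q = p.eval (x 0) / q'.eval (x 0)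
    rw [(hread x).1, (hread x).2]

/-- The open cube `∏_{i : Fin 0} (0,1)` over the empty index type is the whole point `ℝ⁰`. [folklore] -/
theorem pi_univ_Ioo_fin_zero :
    (Set.pi Set.univ (fun _ : Fin 0 => Set.Ioo (0 : ℝ) 1)) = Set.univ :=
  Set.eq_univ_of_forall fun _ => Set.mem_univ_pi.mpr fun i => i.elim0

/-- **Polynomial cubes go to a point**: `[(0,1)ⁿ, P]` (`P ∈ K[z]`) differs by relations from a representation
over the whole point `ℝ⁰` (nothing to do for `n = 0`; otherwise `n − 1` cylinder Stokes steps with `q = 1`, then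
`tateLifting_intervalPolyPoint`). [cite: KontsevichZagier2001, §1.2] -/
theorem cubePoly_toPoint :
    ∀ (n : ℕ) (P : MvPolynomial (Fin n) (algebraicClosure ℚ ℝ)) (r : KZ.IntegralRep n),
      r.domain = Set.pi Set.univ (fun _ => Set.Ioo (0 : ℝ) 1) →
      Set.EqOn r.integrand (fun z => MvPolynomial.aeval z P) r.domain →
      ∃ r₀ : KZ.IntegralRep 0, r₀.domain = Set.univ ∧ KZ.of r - KZ.of r₀ ∈ KZ.relations := by
  intro n
  cases n with
  | zero =>
    intro P r hd _
    exact ⟨r, by rw [hd, pi_univ_Ioo_fin_zero], by rw [sub_self]; exact KZ.relations.zero_mem⟩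
  | succ k =>
    intro P r hd hi
    have hq : ∀ t ∈ Set.Icc (0 : ℝ) 1,
        Polynomial.aeval t (1 : Polynomial (algebraicClosure ℚ ℝ)) ≠ 0 := fun t _ => by
      rw [map_one]; exact one_ne_zero
    have hi' : Set.EqOn r.integrand (fun z => MvPolynomial.aeval z P /
        Polynomial.aeval (z 0) (1 : Polynomial (algebraicClosure ℚ ℝ))) r.domain := fun z hz => by
      rw [hi hz]; simp only [map_one, div_one]
    obtain ⟨P₁, r₁, hd₁, hi₁, hrel⟩ := cylinderReduce k P 1 r hq hd hi'
    have hi₁' : Set.EqOn r₁.integrand (fun z => MvPolynomial.aeval z P₁) r₁.domain := fun z hz => by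
      rw [hi₁ hz]; simp only [map_one, div_one]
    obtain ⟨r₀, hr₀, hrel₀⟩ :=
      tateLifting_intervalPolyPoint tateLifting_cylinderTame P₁ r₁ hd₁ hi₁'
    refine ⟨r₀, hr₀, ?_⟩
    have : KZ.of r - KZ.of r₀ = (KZ.of r - KZ.of r₁) + (KZ.of r₁ - KZ.of r₀) := by abel
    rw [this]
    exact KZ.relations.add_mem hrel hrel₀

/-! ### Reduction of the Fubini generators to the low-dimensional sector

Below, "low-dimensional generator" means an element of the generating set of `kzKernelConjecture_lowDimAlg`
(all representations over `ℝ⁰`; dimension-one representations with integrand `p/q`, `p, q ∈ ℝ[x]` with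
real-algebraic coefficients, `q ≠ 0` on the domain), written out verbatim in every statement. -/

/-- A representation over `ℝ⁰` is a relation (empty domain) or has full domain. [folklore] -/
theorem dimZero_cases (r : KZ.IntegralRep 0) : KZ.of r ∈ KZ.relations ∨ r.domain = Set.univ := by
  by_cases h0 : (default : Fin 0 → ℝ) ∈ r.domain
  · exact Or.inr (Set.eq_univ_of_forall fun x => (Subsingleton.elim default x) ▸ h0)
  · left
    have hdom : r.domain = ∅ :=
      Set.ext fun x => ⟨fun hx => (h0 ((Subsingleton.elim x default) ▸ hx)).elim, fun h => h.elim⟩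
    exact KZ.of_mem_relations_of_volume_eq_zero r (by rw [hdom, measure_empty])

/-- **Multiplying a low-dimensional generator by a point `[pt, a]` gives a low-dimensional generator modulo
relations** (`tateLifting_pointMul`; the scaled integrand `a·p/q` has real-algebraic coefficients because
`a = r₀.integrand pt` is algebraic, `DimOne.dzl_isAlgebraic_integrand`). [cite: KontsevichZagier2001, §4.1] -/
theorem pointMul_low (r₀ : KZ.IntegralRep 0) (h0 : r₀.domain = Set.univ) :
    ∀ g ∈ {d : KZ.FormalRep | (∃ r : KZ.IntegralRep 0, d = KZ.of r) ∨
        ∃ (r : KZ.IntegralRep 1) (p q : Polynomial ℝ), (∀ i, IsAlgebraic ℚ (p.coeff i)) ∧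
          (∀ i, IsAlgebraic ℚ (q.coeff i)) ∧ (∀ x ∈ r.domain, q.eval (x 0) ≠ 0) ∧
          Set.EqOn r.integrand (fun x => p.eval (x 0) / q.eval (x 0)) r.domain ∧ d = KZ.of r},
      ∃ g' ∈ {d : KZ.FormalRep | (∃ r : KZ.IntegralRep 0, d = KZ.of r) ∨
        ∃ (r : KZ.IntegralRep 1) (p q : Polynomial ℝ), (∀ i, IsAlgebraic ℚ (p.coeff i)) ∧
          (∀ i, IsAlgebraic ℚ (q.coeff i)) ∧ (∀ x ∈ r.domain, q.eval (x 0) ≠ 0) ∧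
          Set.EqOn r.integrand (fun x => p.eval (x 0) / q.eval (x 0)) r.domain ∧ d = KZ.of r},
        KZ.of r₀ * g - g' ∈ KZ.relations := by
  rintro g (⟨s, rfl⟩ | ⟨s, p, q, hp, hq, hq0, hread, rfl⟩)
  · obtain ⟨s', _, _, hrel⟩ := tateLifting_pointMul 0 r₀ s h0
    exact ⟨KZ.of s', Or.inl ⟨s', rfl⟩, hrel⟩
  · obtain ⟨s', hd', hi', hrel⟩ := tateLifting_pointMul 1 r₀ s h0
    have ha : IsAlgebraic ℚ (r₀.integrand default) :=
      DimOne.dzl_isAlgebraic_integrand r₀ (by rw [h0]; exact Set.mem_univ _)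
    refine ⟨KZ.of s', Or.inr ⟨s', Polynomial.C (r₀.integrand default) * p, q, fun i => ?_, hq,
      fun x hx => ?_, fun x hx => ?_, rfl⟩, hrel⟩
    · rw [Polynomial.coeff_C_mul]; exact ha.mul (hp i)
    · rw [hd'] at hx; exact hq0 x hx
    · rw [hd'] at hx
      rw [hi' hx]
      show r₀.integrand default * s.integrand x = _
      rw [hread hx]
      simp only [Polynomial.eval_mul, Polynomial.eval_C, mul_div_assoc]

/-- **Every Fubini generator is, modulo relations, in the subgroup generated by the low-dimensional
generators**: low-dimensional generators stay; cylinder generators by `cylinder_toDimOne`; a product `b * g`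
(or `g * b`, by commutativity `KZ.mul_sub_mul_comm_mem_relations`) of a weight-zero factor `b` (a
representation over `ℝ⁰`, or a polynomial cube — reduced to a point by `cubePoly_toPoint`, or a relation when
the point has empty domain, absorbed by the right-ideal property `KZ.mul_mem_relations_right_holds`) with a
low-dimensional or cylinder generator `g` is congruent to `[pt] * g′` (`KZ.mul_sub_mul_mem_relations`) and
then to a low-dimensional generator (`pointMul_low`). [cite: KontsevichZagier2001, §4.1] -/
theorem reduce :
    ∀ d ∈ ({d : KZ.FormalRep | (∃ r : KZ.IntegralRep 0, d = KZ.of r) ∨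
          ∃ (r : KZ.IntegralRep 1) (p q : Polynomial ℝ), (∀ i, IsAlgebraic ℚ (p.coeff i)) ∧
            (∀ i, IsAlgebraic ℚ (q.coeff i)) ∧ (∀ x ∈ r.domain, q.eval (x 0) ≠ 0) ∧
            Set.EqOn r.integrand (fun x => p.eval (x 0) / q.eval (x 0)) r.domain ∧ d = KZ.of r} ∪
        {d : KZ.FormalRep | ∃ (n : ℕ) (P : MvPolynomial (Fin (n + 1)) (algebraicClosure ℚ ℝ))
            (q : Polynomial (algebraicClosure ℚ ℝ)) (r : KZ.IntegralRep (n + 1)),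
          (∀ t ∈ Set.Icc (0 : ℝ) 1, Polynomial.aeval t q ≠ 0) ∧
          r.domain = Set.pi Set.univ (fun _ => Set.Ioo (0 : ℝ) 1) ∧
          Set.EqOn r.integrand (fun z => MvPolynomial.aeval z P / Polynomial.aeval (z 0) q) r.domain ∧
          d = KZ.of r} ∪
        {d : KZ.FormalRep | ∃ b ∈ {d : KZ.FormalRep | (∃ r : KZ.IntegralRep 0, d = KZ.of r) ∨
            ∃ (n : ℕ) (P : MvPolynomial (Fin n) (algebraicClosure ℚ ℝ)) (r : KZ.IntegralRep n),
              r.domain = Set.pi Set.univ (fun _ => Set.Ioo (0 : ℝ) 1) ∧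
              Set.EqOn r.integrand (fun z => MvPolynomial.aeval z P) r.domain ∧ d = KZ.of r},
          ∃ g ∈ ({d : KZ.FormalRep | (∃ r : KZ.IntegralRep 0, d = KZ.of r) ∨
              ∃ (r : KZ.IntegralRep 1) (p q : Polynomial ℝ), (∀ i, IsAlgebraic ℚ (p.coeff i)) ∧
                (∀ i, IsAlgebraic ℚ (q.coeff i)) ∧ (∀ x ∈ r.domain, q.eval (x 0) ≠ 0) ∧
                Set.EqOn r.integrand (fun x => p.eval (x 0) / q.eval (x 0)) r.domain ∧ d = KZ.of r} ∪
            {d : KZ.FormalRep | ∃ (n : ℕ) (P : MvPolynomial (Fin (n + 1)) (algebraicClosure ℚ ℝ))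
                (q : Polynomial (algebraicClosure ℚ ℝ)) (r : KZ.IntegralRep (n + 1)),
              (∀ t ∈ Set.Icc (0 : ℝ) 1, Polynomial.aeval t q ≠ 0) ∧
              r.domain = Set.pi Set.univ (fun _ => Set.Ioo (0 : ℝ) 1) ∧
              Set.EqOn r.integrand (fun z => MvPolynomial.aeval z P / Polynomial.aeval (z 0) q)
                r.domain ∧ d = KZ.of r}),
          d = b * g ∨ d = g * b}),
      ∃ ℓ ∈ AddSubgroup.closure
          {d : KZ.FormalRep | (∃ r : KZ.IntegralRep 0, d = KZ.of r) ∨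
            ∃ (r : KZ.IntegralRep 1) (p q : Polynomial ℝ), (∀ i, IsAlgebraic ℚ (p.coeff i)) ∧
              (∀ i, IsAlgebraic ℚ (q.coeff i)) ∧ (∀ x ∈ r.domain, q.eval (x 0) ≠ 0) ∧
              Set.EqOn r.integrand (fun x => p.eval (x 0) / q.eval (x 0)) r.domain ∧ d = KZ.of r},
        d - ℓ ∈ KZ.relations := by
  -- name the three generating sets
  set L := {d : KZ.FormalRep | (∃ r : KZ.IntegralRep 0, d = KZ.of r) ∨
      ∃ (r : KZ.IntegralRep 1) (p q : Polynomial ℝ), (∀ i, IsAlgebraic ℚ (p.coeff i)) ∧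
        (∀ i, IsAlgebraic ℚ (q.coeff i)) ∧ (∀ x ∈ r.domain, q.eval (x 0) ≠ 0) ∧
        Set.EqOn r.integrand (fun x => p.eval (x 0) / q.eval (x 0)) r.domain ∧ d = KZ.of r} with hL
  set C := {d : KZ.FormalRep | ∃ (n : ℕ) (P : MvPolynomial (Fin (n + 1)) (algebraicClosure ℚ ℝ))
      (q : Polynomial (algebraicClosure ℚ ℝ)) (r : KZ.IntegralRep (n + 1)),
    (∀ t ∈ Set.Icc (0 : ℝ) 1, Polynomial.aeval t q ≠ 0) ∧
    r.domain = Set.pi Set.univ (fun _ => Set.Ioo (0 : ℝ) 1) ∧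
    Set.EqOn r.integrand (fun z => MvPolynomial.aeval z P / Polynomial.aeval (z 0) q) r.domain ∧
    d = KZ.of r} with hC
  set W := {d : KZ.FormalRep | (∃ r : KZ.IntegralRep 0, d = KZ.of r) ∨
      ∃ (n : ℕ) (P : MvPolynomial (Fin n) (algebraicClosure ℚ ℝ)) (r : KZ.IntegralRep n),
        r.domain = Set.pi Set.univ (fun _ => Set.Ioo (0 : ℝ) 1) ∧
        Set.EqOn r.integrand (fun z => MvPolynomial.aeval z P) r.domain ∧ d = KZ.of r} with hW
  -- low-dimensional and cylinder generators are low-dimensional generators modulo relations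
  have hLC : ∀ g ∈ L ∪ C, ∃ g' ∈ L, g - g' ∈ KZ.relations := by
    rintro g (hg | ⟨n, P, q, r, hq, hd, hi, rfl⟩)
    · exact ⟨g, hg, by rw [sub_self]; exact KZ.relations.zero_mem⟩
    · obtain ⟨ρ, p, q', hp, hq', hq0, hread, hrel⟩ := cylinder_toDimOne n P q r hq hd hi
      exact ⟨KZ.of ρ, Or.inr ⟨ρ, p, q', hp, hq', hq0, hread, rfl⟩, hrel⟩
  -- weight-zero factors are relations or points with full domain, modulo relations
  have hW0 : ∀ b ∈ W, b ∈ KZ.relations ∨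
      ∃ r₀ : KZ.IntegralRep 0, r₀.domain = Set.univ ∧ b - KZ.of r₀ ∈ KZ.relations := by
    rintro b (⟨r, rfl⟩ | ⟨n, P, r, hd, hi, rfl⟩)
    · rcases dimZero_cases r with h | h
      · exact Or.inl h
      · exact Or.inr ⟨r, h, by rw [sub_self]; exact KZ.relations.zero_mem⟩
    · exact Or.inr (cubePoly_toPoint n P r hd hi)
  rintro d ((hd | hd) | ⟨b, hb, g, hg, hdg⟩)
  · exact ⟨d, AddSubgroup.subset_closure hd, by rw [sub_self]; exact KZ.relations.zero_mem⟩
  · obtain ⟨g', hg', hrel⟩ := hLC d (Or.inr hd)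
    exact ⟨g', AddSubgroup.subset_closure hg', hrel⟩
  · have key : ∃ ℓ ∈ AddSubgroup.closure L, b * g - ℓ ∈ KZ.relations := by
      obtain ⟨g', hg', hgg'⟩ := hLC g hg
      rcases hW0 b hb with hbrel | ⟨r₀, h0, hb0⟩
      · exact ⟨0, zero_mem _, by rw [sub_zero]; exact KZ.mul_mem_relations_right_holds _ _ hbrel⟩
      · obtain ⟨ℓ, hℓ, hrel⟩ := pointMul_low r₀ h0 g' hg'
        refine ⟨ℓ, AddSubgroup.subset_closure hℓ, ?_⟩
        have h1 : b * g - KZ.of r₀ * g' ∈ KZ.relations := KZ.mul_sub_mul_mem_relations hb0 hgg'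
        have : b * g - ℓ = (b * g - KZ.of r₀ * g') + (KZ.of r₀ * g' - ℓ) := by abel
        rw [this]
        exact KZ.relations.add_mem h1 hrel
    obtain ⟨ℓ, hℓ, hrel⟩ := key
    rcases hdg with rfl | rfl
    · exact ⟨ℓ, hℓ, hrel⟩
    · refine ⟨ℓ, hℓ, ?_⟩
      have : g * b - ℓ = (g * b - b * g) + (b * g - ℓ) := by abel
      rw [this]
      exact KZ.relations.add_mem (KZ.mul_sub_mul_comm_mem_relations g b) hrel

/-- From a kernel statement on `closure S` to pairs of generators with the same value. [folklore] -/
theorem equivalent_of_kernel {S : Set KZ.FormalRep}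
    (hK : ∀ c ∈ AddSubgroup.closure S, KZ.eval c = 0 → c ∈ KZ.relations)
    {n m : ℕ} {r : KZ.IntegralRep n} {r' : KZ.IntegralRep m} (hr : KZ.of r ∈ S) (hr' : KZ.of r' ∈ S)
    (hv : r.value = r'.value) : KZ.Equivalent r r' :=
  hK _ (sub_mem (AddSubgroup.subset_closure hr) (AddSubgroup.subset_closure hr'))
    (by rw [map_sub, KZ.eval_of, KZ.eval_of, hv, sub_self])

end Fubini


/-- **Polynomial cubes go to a point** (top-level packaging of `Fubini.cubePoly_toPoint`, the registered
assembly statement of this file): `[(0,1)ⁿ, P]`, `P ∈ K[z₁..z_n]`, differs by relations from a representation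
over the whole point `ℝ⁰`. [cite: KontsevichZagier2001, §1.2] -/
theorem tateLifting_cubePolyPoint :
    ∀ (n : ℕ) (P : MvPolynomial (Fin n) (algebraicClosure ℚ ℝ)) (r : KZ.IntegralRep n),
      r.domain = Set.pi Set.univ (fun _ => Set.Ioo (0 : ℝ) 1) →
      Set.EqOn r.integrand (fun z => MvPolynomial.aeval z P) r.domain →
      ∃ r₀ : KZ.IntegralRep 0, r₀.domain = Set.univ ∧ KZ.of r - KZ.of r₀ ∈ KZ.relations :=
  Fubini.cubePoly_toPoint

end Summit.KontsevichZagierPeriods.InverseLandau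

end
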